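import Summits.MatrixMultiplication.MatrixMultiplication.Theorems.AbelianSTPPCensusTECertWlog
import Summits.MatrixMultiplication.MatrixMultiplication.Theorems.AbelianSTPPCensusTECertEvalA
import Summits.MatrixMultiplication.MatrixMultiplication.Theorems.AbelianSTPPCensusTECertEvalB
import Summits.MatrixMultiplication.MatrixMultiplication.Theorems.AbelianSTPPCensusTECertEvalC
import Summits.MatrixMultiplication.MatrixMultiplication.Theorems.AbelianSTPPCensusTECertEvalD
import Summits.MatrixMultiplication.MatrixMultiplication.Theses.AbelianSTPPCensus
import Summits.MatrixMultiplication.MatrixMultiplication.Theorems.AbelianSTPPCensusLeafTE127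
import Summits.MatrixMultiplication.MatrixMultiplication.Theorems.AbelianSTPPCensusShapeCertFinal

/-!
# Crux `ShapeExclusionTE` of route `AbelianSTPPCensus`: the kernel certificate, assembled

Cell mm-stpp, rung F-M1; item stmt-MatrixMultiplication-19759.  From the route's predicates to the checker's
(`SieveAdmissible ⇒ AdmM` on the multiset of shapes; `Beats (5/2) ⇒ 100·M < Σ qOf V` by `V^{5/6} ≤ qOf V / 100`;
a sub-multiset of the shape multiset is realised at distinct indices, `HasSubShapes`), the coverage of every order
`M ≤ 127` by the kernel evaluations of `…TECertEval{A,B,C,D}` (`TECert.teCovered`), and the conditional closing theorem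
`TECert.shapeExclusionTE_of_covered`; the crux itself was closed first by eng-2's lineage B (`ShapeCert`, p414236), so
lineage A's last step `shapeExclusionTE_of_covered teCovered : ShapeExclusionTE` and the rung leaf are recorded as
kernel-checked `example`s (a named twin of a landed statement is refused by the gate).
WHAT THIS IS NOT: no `ω` statement; `SieveSound`, the residual cruxes and the assembly are other items of the route.
-/

-- single-conjunct summit: the mandated namespace repeats `MatrixMultiplication`.
set_option linter.dupNamespace false

namespace Summit.MatrixMultiplication.MatrixMultiplication.Theorems.TECert

/-! ## From the route's predicates to the checker's -/

section RouteBridge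

open Summit.MatrixMultiplication.MatrixMultiplication.Theorems

variable {N M : ℕ} {a b c : Fin N → ℕ}

/-- The multiset of shapes of a family given by size functions. -/
theorem mem_shapes {t : ℕ × ℕ × ℕ} :
    t ∈ (Finset.univ : Finset (Fin N)).val.map (fun i => (a i, b i, c i)) ↔ ∃ i, (a i, b i, c i) = t := by
  simp

/-- The sums of the shape multiset of a family given by size functions. -/
theorem sums_shapes :
    sumP ((Finset.univ : Finset (Fin N)).val.map (fun i => (a i, b i, c i))) = ∑ i, a i * b i ∧
    sumQ ((Finset.univ : Finset (Fin N)).val.map (fun i => (a i, b i, c i))) = ∑ i, b i * c i ∧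
    sumR ((Finset.univ : Finset (Fin N)).val.map (fun i => (a i, b i, c i))) = ∑ i, c i * a i ∧
    sumVal ((Finset.univ : Finset (Fin N)).val.map (fun i => (a i, b i, c i))) = ∑ i, qOf (a i * b i * c i) := by
  refine ⟨?_, ?_, ?_, ?_⟩ <;>
    simp [sumP, sumQ, sumR, sumVal, Function.comp_def, uu, vv, ww, vol, Finset.sum_eq_multiset_sum]

/-- `SieveAdmissible` (with at least two members) implies the checker's hypothesis `AdmM`. -/
theorem admM_of_sieveAdmissible (hN : 2 ≤ N) (hS : SieveAdmissible M a b c) :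
    AdmM M ((Finset.univ : Finset (Fin N)).val.map (fun i => (a i, b i, c i))) := by
  obtain ⟨eP, eQ, eR, -⟩ := sums_shapes (a := a) (b := b) (c := c)
  obtain ⟨h1, h2, h3, h4, h5, h6, -⟩ := hS
  haveI : Nontrivial (Fin N) := Fin.nontrivial_iff_two_le.mpr hN
  have hsum : ∀ l, (∑ t ∈ Finset.univ.erase l, a t * b t) + a l * b l = ∑ i, a i * b i ∧
      (∑ t ∈ Finset.univ.erase l, b t * c t) + b l * c l = ∑ i, b i * c i ∧
      (∑ t ∈ Finset.univ.erase l, c t * a t) + c l * a l = ∑ i, c i * a i := fun l =>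
    ⟨by rw [add_comm]; exact Finset.add_sum_erase _ (fun t => a t * b t) (Finset.mem_univ l),
     by rw [add_comm]; exact Finset.add_sum_erase _ (fun t => b t * c t) (Finset.mem_univ l),
     by rw [add_comm]; exact Finset.add_sum_erase _ (fun t => c t * a t) (Finset.mem_univ l)⟩
  refine ⟨?_, ?_, ?_, ?_⟩
  · intro t ht
    obtain ⟨i, rfl⟩ := mem_shapes.mp ht
    obtain ⟨ha, hb, hc, hV⟩ := h1 i
    obtain ⟨n1, n2, n3⟩ := h2 i
    obtain ⟨j, hj⟩ := exists_ne i
    obtain ⟨u1, u2, u3, -⟩ := h5 i j hj.symm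
    refine ⟨ha, hb, hc, (tableOK_iff _ _ _ _).mpr ⟨hV, n1, n2, n3, u1, u2, u3⟩⟩
  · rw [eP, eQ, eR]; exact h3
  · intro t ht
    obtain ⟨i, rfl⟩ := mem_shapes.mp ht
    obtain ⟨hA, hB, hC⟩ := h4 i
    have dA : ∑ j, a j * (b j + c j) = (∑ j, a j * b j) + ∑ j, c j * a j := by
      rw [← Finset.sum_add_distrib]; exact Finset.sum_congr rfl fun j _ => by ring
    have dB : ∑ j, b j * (c j + a j) = (∑ j, a j * b j) + ∑ j, b j * c j := by
      rw [← Finset.sum_add_distrib]; exact Finset.sum_congr rfl fun j _ => by ring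
    have dC : ∑ j, c j * (a j + b j) = (∑ j, b j * c j) + ∑ j, c j * a j := by
      rw [← Finset.sum_add_distrib]; exact Finset.sum_congr rfl fun j _ => by ring
    rw [eP, eQ, eR]
    refine ⟨?_, ?_, ?_⟩
    · rw [← dA]; exact hA
    · rw [← dB]; exact hB
    · rw [← dC]; exact hC
  · intro t ht
    obtain ⟨l, rfl⟩ := mem_shapes.mp ht
    obtain ⟨hab, habt, hbc, hbct, hca, hcat⟩ := h6 l
    obtain ⟨sA, sB, sC⟩ := hsum l
    simp only [u14Sum, shapeVol] at hab habt hbc hbct hca hcat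
    rw [eP, eQ, eR]
    simp only [vol, uu, vv, ww, HasLargeCommonDivisor] at *
    refine ⟨⟨by omega, fun h => habt (by omega)⟩, ⟨by omega, fun h => hbct (by omega)⟩,
      ⟨by omega, fun h => hcat (by omega)⟩⟩

/-- The value table: `K^6 · V^5 ≤ (qOf V)^6` for `V < 128`. -/
theorem qtab_pow (V : ℕ) (hV : V < 128) : K ^ 6 * V ^ 5 ≤ qOf V ^ 6 := by
  have h : qtabOK = true := by decide +kernel
  simp only [qtabOK, List.all_eq_true, List.mem_range, decide_eq_true_eq] at h
  exact h V hV

/-- `V^{5/6} ≤ qOf V / K` over the reals. -/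
theorem rpow_le_qOf (V : ℕ) (hV : V < 128) : (V : ℝ) ^ ((5 : ℝ) / 2 / 3) ≤ (qOf V : ℝ) / K := by
  have hK : (0 : ℝ) < K := by norm_num [K]
  have hx : (0 : ℝ) ≤ V := Nat.cast_nonneg _
  have hy : (0 : ℝ) ≤ (qOf V : ℝ) / K := by positivity
  have h' : (V : ℝ) ^ (5 : ℕ) ≤ ((qOf V : ℝ) / K) ^ (6 : ℕ) := by
    rw [div_pow, le_div_iff₀ (by positivity)]
    have := qtab_pow V hV
    calc (V : ℝ) ^ 5 * (K : ℝ) ^ 6 = ((K ^ 6 * V ^ 5 : ℕ) : ℝ) := by push_cast; ring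
      _ ≤ ((qOf V ^ 6 : ℕ) : ℝ) := by exact_mod_cast this
      _ = (qOf V : ℝ) ^ 6 := by push_cast; ring
  have e : ((5 : ℝ) / 2 / 3) = ((5 : ℕ) : ℝ) * (((6 : ℕ) : ℝ)⁻¹) := by norm_num
  rw [e, Real.rpow_mul hx, Real.rpow_natCast]
  calc ((V : ℝ) ^ 5) ^ (((6 : ℕ) : ℝ)⁻¹) ≤ (((qOf V : ℝ) / K) ^ 6) ^ (((6 : ℕ) : ℝ)⁻¹) :=
        Real.rpow_le_rpow (by positivity) h' (by positivity)
    _ = (qOf V : ℝ) / K := Real.pow_rpow_inv_natCast hy (by norm_num)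

/-- `Beats (5/2)` implies the integer value test of the checker. -/
theorem beats_sumVal (hV : ∀ i, a i * b i * c i ≤ 127) (hB : Beats (5 / 2) M a b c) :
    K * M < sumVal ((Finset.univ : Finset (Fin N)).val.map (fun i => (a i, b i, c i))) := by
  obtain ⟨-, -, -, eV⟩ := sums_shapes (a := a) (b := b) (c := c)
  rw [eV]
  unfold Beats at hB
  simp only [shapeVol] at hB
  have hK : (0 : ℝ) < K := by norm_num [K]
  have hle : ∑ i, ((a i * b i * c i : ℕ) : ℝ) ^ ((5 : ℝ) / 2 / 3) ≤ ∑ i, (qOf (a i * b i * c i) : ℝ) / K :=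
    Finset.sum_le_sum fun i _ => rpow_le_qOf _ (by have := hV i; omega)
  rw [← Finset.sum_div] at hle
  have h1 : (M : ℝ) < (∑ i, (qOf (a i * b i * c i) : ℝ)) / K := lt_of_lt_of_le hB hle
  rw [lt_div_iff₀ hK] at h1
  have h2 : ((K * M : ℕ) : ℝ) < ((∑ i, qOf (a i * b i * c i) : ℕ) : ℝ) := by push_cast; linarith
  exact_mod_cast h2

/-- A sub-multiset of the shape multiset is `HasSubShapes`. -/
theorem hasSubShapes_of_le {L : List (ℕ × ℕ × ℕ)}
    (h : (L : Multiset (ℕ × ℕ × ℕ)) ≤ (Finset.univ : Finset (Fin N)).val.map (fun i => (a i, b i, c i))) :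
    HasSubShapes a b c L := by
  -- the injective choice of indices is eng-2's `ShapeCert.exists_emb_of_le` (same directory, landed first)
  obtain ⟨φ, -, hφ⟩ := ShapeCert.exists_emb_of_le (fun i => (a i, b i, c i)) L Finset.univ h
  exact ⟨φ, hφ⟩

/-- **The crux from coverage.** If every order `M ≤ 127` is covered by accepted certificate chunks, then
`ShapeExclusionTE` holds. -/
theorem shapeExclusionTE_of_covered (hcov : ∀ M, M ≤ 127 → Covered M) :
    Summit.MatrixMultiplication.MatrixMultiplication.Theses.AbelianSTPPCensus.ShapeExclusionTE := by
  intro N M a b c hN hM hS hB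
  have hA := admM_of_sieveAdmissible hN hS
  have hV : ∀ i, a i * b i * c i ≤ 127 := fun i => (hS.1 i).2.2.2.trans hM
  have hb := beats_sumVal hV hB
  obtain ⟨L, hL, hle⟩ := residual_of_adm hM (hcov M hM) hA hb
  unfold residLists at hL
  split_ifs at hL with e1 e2 e3 e4 e5 <;>
    simp only [List.mem_cons, List.not_mem_nil, or_false] at hL
  · subst hL; exact Or.inl ⟨e1, hasSubShapes_of_le hle⟩
  · refine Or.inr (Or.inl ⟨e2, ?_⟩)
    rcases hL with rfl | rfl | rfl
    · exact Or.inl (hasSubShapes_of_le hle)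
    · exact Or.inr (Or.inl (hasSubShapes_of_le hle))
    · exact Or.inr (Or.inr (hasSubShapes_of_le hle))
  · refine Or.inr (Or.inr (Or.inl ⟨e3, ?_⟩))
    rcases hL with rfl | rfl | rfl | rfl
    · exact Or.inl (hasSubShapes_of_le hle)
    · exact Or.inr (Or.inl (hasSubShapes_of_le hle))
    · exact Or.inr (Or.inr (Or.inl (hasSubShapes_of_le hle)))
    · exact Or.inr (Or.inr (Or.inr (hasSubShapes_of_le hle)))
  · refine Or.inr (Or.inr (Or.inr (Or.inl ⟨e4, ?_⟩)))
    rcases hL with rfl | rfl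
    · exact Or.inl (hasSubShapes_of_le hle)
    · exact Or.inr (hasSubShapes_of_le hle)
  · refine Or.inr (Or.inr (Or.inr (Or.inr ⟨e5, ?_⟩)))
    subst hL; exact hasSubShapes_of_le hle

end RouteBridge

/-! ## All orders `M ≤ 127` are covered by the evaluated chunks -/

/-- Coverage of a single order from one whole-range chunk. -/
theorem covered_single {M : ℕ} (h : teCheck M 0 1000 = true) (hM : M ≤ 127) : Covered M :=
  covered_of_teCheck [(0, 1000)] (by simpa using h) fun V₁ _ h2 => ⟨(0, 1000), by simp, Nat.zero_le _, by omega⟩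

/-- Every order `M ≤ 127` is covered by the accepted certificate chunks (`…TECertEval{A,B,C,D}`). -/
theorem teCovered (M : ℕ) (hM : M ≤ 127) : Covered M := by
  rcases Nat.lt_or_ge M 42 with h1 | h1
  · exact covered_of_teBatch te_0_42 (Nat.zero_le _) (by omega)
  rcases Nat.lt_or_ge M 62 with h2 | h2
  · exact covered_of_teBatch te_42_20 h1 (by omega)
  rcases Nat.lt_or_ge M 76 with h3 | h3
  · exact covered_of_teBatch te_62_14 h2 (by omega)
  rcases Nat.lt_or_ge M 86 with h4 | h4
  · exact covered_of_teBatch te_76_10 h3 (by omega)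
  rcases Nat.lt_or_ge M 94 with h5 | h5
  · exact covered_of_teBatch te_86_8 h4 (by omega)
  rcases Nat.lt_or_ge M 101 with h6 | h6
  · exact covered_of_teBatch te_94_7 h5 (by omega)
  rcases Nat.lt_or_ge M 106 with h7 | h7
  · exact covered_of_teBatch te_101_5 h6 (by omega)
  rcases Nat.lt_or_ge M 110 with h8 | h8
  · exact covered_of_teBatch te_106_4 h7 (by omega)
  rcases Nat.lt_or_ge M 114 with h9 | h9
  · exact covered_of_teBatch te_110_4 h8 (by omega)
  interval_cases M
  · exact covered_single te_114 hM
  · exact covered_of_teBatch te_115_3 (by norm_num) (by norm_num)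
  · exact covered_of_teBatch te_115_3 (by norm_num) (by norm_num)
  · exact covered_of_teBatch te_115_3 (by norm_num) (by norm_num)
  · exact covered_single te_118 hM
  · exact covered_single te_119 hM
  · exact covered_of_teBatch te_120_2 (by norm_num) (by norm_num)
  · exact covered_of_teBatch te_120_2 (by norm_num) (by norm_num)
  · exact covered_single te_122 hM
  · exact covered_single te_123 hM
  · exact covered_single te_124 hM
  · exact covered_single te_125 hM
  · exact covered_single te_126 hM
  · refine covered_of_teCheck [(0, 75), (75, 80), (80, 1000)] ?_ ?_
    · intro p hp
      simp only [List.mem_cons, List.not_mem_nil, or_false] at hp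
      rcases hp with rfl | rfl | rfl
      · exact te_127a
      · exact te_127b
      · exact te_127c
    · intro V₁ _ h2
      rcases Nat.lt_or_ge V₁ 75 with h | h
      · exact ⟨(0, 75), by simp, Nat.zero_le _, h⟩
      rcases Nat.lt_or_ge V₁ 80 with h' | h'
      · exact ⟨(75, 80), by simp, h, h'⟩
      · exact ⟨(80, 1000), by simp, h', by omega⟩

end TECert

/-! ## The crux and the rung leaf, second kernel lineage

The crux `ShapeExclusionTE` was CLOSED at 2026-08-26T00:36Z by eng-2's lineage B (`ShapeCert`,
`…Theorems.ShapeExclusionTE_proof`, p414236).  The gate refuses textual twins of landed statements, so lineage A's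
closing step is recorded as kernel-checked `example`s: `TECert.shapeExclusionTE_of_covered TECert.teCovered` is a
second, code-disjoint kernel proof of the crux, and with theory's `AbelianTECensus.noAbelianSTPPHost_250_127_of_…`
of the rung leaf. -/

/-- Lineage A closes the crux (kernel-checked; not a named declaration because the statement is already landed). -/
example : Summit.MatrixMultiplication.MatrixMultiplication.Theses.AbelianSTPPCensus.ShapeExclusionTE :=
  TECert.shapeExclusionTE_of_covered TECert.teCovered

/-- Lineage A yields the rung leaf `NoAbelianSTPPHost_250_127` (kernel-checked example). -/
example : NoAbelianSTPPHost_250_127 :=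
  AbelianTECensus.noAbelianSTPPHost_250_127_of_shapeExclusionTE
    (TECert.shapeExclusionTE_of_covered TECert.teCovered)

namespace TECert

end Summit.MatrixMultiplication.MatrixMultiplication.Theorems.TECert
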